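import Summits.QuantumFields.YangMills.Theses.BalabanUVNodes
import Summits.QuantumFields.YangMills.Theorems.BalabanUVNodesN27AtRecord13CoPRHomeOn
import Summits.QuantumFields.YangMills.Theorems.BalabanUVNodesN27AtReadingOfRecord13CoPR

/-!
# BalabanUVNodes ∕ N27 = binder B5 AT THE RECORD, XXXVII⁶ (leaf B) — K3⁶ `Theses.BalabanUVNodes.SpineGivenEndpointR13SepCoPR` FROM THE STUB INSTANCES AT THE CoPR-KEYED CARRIER HOMES OF RECORD
# (XXXVIIIᶜᵒᴾᴿ `…N27AtRecord13CoPRHome` at `SRec₁₃CoPR cr`∕`RRec₁₃CoPR 𝔯`; XXXIXᶜᵒᴾᴿ `…N27AtRecord13CoPRHomeOn` at `SRec₁₃CoPROn cr Rg`∕`RRec₁₃CoPROn 𝔯 Rg` with the guard reaching every hypothesis) AND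
# AT dag-n22-e's CoPR rate reading of record (XLᶜᵒᴾᴿ `…N27AtReadingOfRecord13CoPR`), each in ONE application at `hc := hP.toCore` (datum `rfl`) through the one-way door «`Spine` at the CoPR-keyed class
# ⇒ the item» (XXXVIᶜᵒᴾᴿ `keyedGuarded₁₃CoPR_of_spine_rec13CCoPR` ∕ `spine_rec13CCoPRN_iff_forall_guarded` ∕ `spine_rec13CCoPROn_iff_forall_guarded`); = §§5–8 of the ‴∕⁗ module XXXVII; leaf A
# `…N27SpineGivenEndpointR13SepCoPR` holds §§1–4
# (cell `pub-ymgap`, HUMAN RULING D-0062 Track A, R134 seat `pub-ymgap-dag-n27-c` (s2); `--kind proof --supports <K3⁶ id> --as helper`; COUNT-NEUTRAL; route-facing LEAF — nothing may import it)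

HONEST FRAMING.  As leaf A: every stub ∕ reading ∕ edge a HYPOTHESIS (0∕1), readings PARAMETERS, K3⁶ NOT claimed, no inhabitant claimed, nothing of Bałaban's asserted, NO node discharged,
counts UNMOVED (28∕28 · 5∕27, A 5∕28); NOT ℝ⁴ ∕ OS ∕ mass gap ∕ Clay.  0 `def`, 0 `sorry`.  
-/

namespace Summit.QuantumFields.YangMills.Theorems.BalabanUVNodesN27SpineRecord

open Literature.MathematicalPhysics.QuantumFieldTheory.Balaban1983to89
open Literature.MathematicalPhysics.QuantumFieldTheory.Balaban1983to89.T4Continuum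
open T4WeightBudget (RelWeightBound)
open T4IndicatorShell (ShellWeightBound)
open T4ContinuumYM4Torus (ForSmallCouplings)
open Summit.QuantumFields.BalabanUV.T4Continuum.Spine
open Summit.QuantumFields.YangMills.Theses.BalabanUVNodes (SpineGivenEndpointR13SepCoPR)
open YMDAG.UVSplit
open Node00 (Stage13RParams datumOfRecord₁₃SepCoPR datumOfRecord₁₃CoPR IsRecordOfRecord₁₃CCoPR)

/-! ## §5 The item from the Stage-13 CARRIER HOMES OF RECORD (module XXXVIIIᶜᵒᴾᴿ by name) — `S_R00x` discharged at the home -/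

section Homes

variable (cr₁₃ : SpineReading₁₃CoPR 2) (𝔯 : RateReading₁₃CoPR 2)

/-- **THE ITEM FROM THE STUB INSTANCES OF THE TWO STAGE-13 CARRIER HOMES OF RECORD AND THE HOME-KEYED N19′ EDGE** (`N = 2`; XXXVIIIᶜᵒᴾᴿ `spine_rec13CCoPR_of_homes₁₃CoPR` ∘ §1): the six K4 stubs at
(T-RATE)₁₃ `RRec₁₃CoPR 𝔯`, the three K5 stubs at (T-SPINE)₁₃ `SRec₁₃CoPR cr₁₃`, and `h19` (for every admissible θ, every datum key `h` of θ's datum, every run length `k`: the rates at the canonical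
bundle `rateCarriersOfRecord₁₃CoPR 𝔯 F h.params h.provisos g₀ os k` give a summable `δ` carrying `Spine.NE7.Core` on the cores of `cr₁₃ F θ hP g₀ os`) ⇒ `SpineGivenEndpointR13SepCoPR` — `S_R00x`
is NOT asked (proved at the home, `s_R00x_rRec₁₃CoPR`).  Every remaining stub 0∕1 today; `cr₁₃`, `𝔯` the homes' PARAMETERS. [bookkeeping] -/
theorem spineGivenEndpointR13SepCoPR_of_homes₁₃CoPR (h14 : S_N14 (RRec₁₃CoPR 𝔯)) (h15 : S_N15 (RRec₁₃CoPR 𝔯)) (h16 : S_N16 (RRec₁₃CoPR 𝔯)) (h17 : S_N17 (RRec₁₃CoPR 𝔯))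
    (h18 : S_N18 (RRec₁₃CoPR 𝔯)) (h22 : S_N22 (RRec₁₃CoPR 𝔯)) (hx' : S_N27x (fun F D w => IsRecordOfRecord₁₃CCoPR F 2 D w) (SRec₁₃CoPR cr₁₃)) (h20 : S_N20 (SRec₁₃CoPR cr₁₃))
    (h21 : S_N21 (SRec₁₃CoPR cr₁₃))
    (h19 : ∀ (F : T4Family) (θ : Stage13RParams F 2) (hP : θ.Provisos₁₃CoPR F 2), θ.Admissible F 2 → ∀ (g₀ : ℕ → ℝ) (os : List (ULoop F))
      (h : Node00.IsDatumOfRecord₁₃CCoPR F 2 (datumOfRecord₁₃CoPR F 2 θ hP)) (k : ℕ),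
      RatesAt (datumOfRecord₁₃CoPR F 2 θ hP) (rateCarriersOfRecord₁₃CoPR 𝔯 F h.params h.provisos g₀ os k) → letI := (cr₁₃ F θ hP g₀ os).dec
        ∃ δ : ℕ → ℝ, NE7.Core (cr₁₃ F θ hP g₀ os).l₀ (cr₁₃ F θ hP g₀ os).vol (cr₁₃ F θ hP g₀ os).T (cr₁₃ F θ hP g₀ os).Bad
          (fun K t τ => (cr₁₃ F θ hP g₀ os).A K t τ - (cr₁₃ F θ hP g₀ os).shA K t τ)
          (fun K t τ => (cr₁₃ F θ hP g₀ os).B K t τ - (cr₁₃ F θ hP g₀ os).shB K t τ) δ ∧ Summable δ) :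
    SpineGivenEndpointR13SepCoPR :=
  fun F θ hP hG hθ hB hE =>
    keyedGuarded₁₃CoPR_of_spine_rec13CCoPR (fun θ => θ.ZrUnity _ 2 ∧ θ.SlotsNondegenerate₁₃ _ 2)
      (spine_rec13CCoPR_of_homes₁₃CoPR cr₁₃ 𝔯 h14 h15 h16 h17 h18 h22 hx' h20 h21 h19) F θ hP.toCore hG hθ hB hE

end Homes

/-! ## §6 The item from the REGIME-RESTRICTED Stage-13 carrier homes at the item's guard (module XXXIXᶜᵒᴾᴿ by name) — the guard
`θ.ZrUnity F 2 ∧ θ.SlotsNondegenerate₁₃ F 2` REACHES BOTH HOMES AND THE EDGE (dag-ref-H XXVII-PRE-READ-NOTE shape (b)); no canonical parameter, `S_R00x` not asked -/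

section HomesOn

variable (cr₁₃ : SpineReading₁₃CoPR 2) (𝔯 : RateReading₁₃CoPR 2)

/-- **THE ITEM FROM THE STUB INSTANCES OF THE TWO REGIME-RESTRICTED STAGE-13 CARRIER HOMES AT THE ITEM'S OWN GUARD** (`N = 2`; XXXIXᶜᵒᴾᴿ `forall_guarded₁₃CoPR_of_homes₁₃CoPROn` at
`Rg F θ := θ.ZrUnity F 2 ∧ θ.SlotsNondegenerate₁₃ F 2` ∘ §1 `spineGivenEndpointR13SepCoPR_iff_keyedGuarded`): the six K4 stubs at (T-RATE)₁₃ `RRec₁₃CoPROn 𝔯 Rg` and the K5 stubs `S_N20`, `S_N21` at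
(T-SPINE)₁₃ `SRec₁₃CoPROn cr₁₃ Rg` — each IS its node's estimate asked ONLY of the admissible Stage-13 tuples with provisos satisfying the guard, read AT the tuple (n22-e `s_N1x_rRec₁₃SepOn_iff`,
n20-d `s_N20_sRec₁₃SepOn_iff`) — the keyed extraction clause `hx` (positivity + E1∕E2 under (B), END, small tuned couplings) and the SAME-TUPLE, ALL-RUN-LENGTHS N19′ edge `h19`, both asked
only under the guard ⇒ `SpineGivenEndpointR13SepCoPR`.  Unlike §5's `_of_homes₁₃CoPR` (canonical homes, edge read at `h.params`, stubs at EVERY admissible tuple), here the item's guard is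
supplied to EVERY hypothesis and nothing is read at a canonical parameter.  Every hypothesis 0∕1 today; `cr₁₃`, `𝔯` the homes' PARAMETERS. [bookkeeping] -/
theorem spineGivenEndpointR13SepCoPR_of_homes₁₃CoPROn
    (h14 : S_N14 (RRec₁₃CoPROn 𝔯 fun F θ => θ.ZrUnity F 2 ∧ θ.SlotsNondegenerate₁₃ F 2)) (h15 : S_N15 (RRec₁₃CoPROn 𝔯 fun F θ => θ.ZrUnity F 2 ∧ θ.SlotsNondegenerate₁₃ F 2))
    (h16 : S_N16 (RRec₁₃CoPROn 𝔯 fun F θ => θ.ZrUnity F 2 ∧ θ.SlotsNondegenerate₁₃ F 2)) (h17 : S_N17 (RRec₁₃CoPROn 𝔯 fun F θ => θ.ZrUnity F 2 ∧ θ.SlotsNondegenerate₁₃ F 2))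
    (h18 : S_N18 (RRec₁₃CoPROn 𝔯 fun F θ => θ.ZrUnity F 2 ∧ θ.SlotsNondegenerate₁₃ F 2)) (h22 : S_N22 (RRec₁₃CoPROn 𝔯 fun F θ => θ.ZrUnity F 2 ∧ θ.SlotsNondegenerate₁₃ F 2))
    (h20 : S_N20 (SRec₁₃CoPROn cr₁₃ fun F θ => θ.ZrUnity F 2 ∧ θ.SlotsNondegenerate₁₃ F 2)) (h21 : S_N21 (SRec₁₃CoPROn cr₁₃ fun F θ => θ.ZrUnity F 2 ∧ θ.SlotsNondegenerate₁₃ F 2))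
    (hx : ∀ (F : T4Family) (θ : Stage13RParams F 2) (hP : θ.Provisos₁₃CoPR F 2), (θ.ZrUnity F 2 ∧ θ.SlotsNondegenerate₁₃ F 2) → θ.Admissible F 2 →
      B16.EndStatementBPrinted (datumOfRecord₁₃CoPR F 2 θ hP).C → DagBinding.EndpointExistence (datumOfRecord₁₃CoPR F 2 θ hP).C.toB12 →
        ForSmallCouplings (datumOfRecord₁₃CoPR F 2 θ hP) fun g₀ => ∀ os : List (ULoop F),
          0 < (cr₁₃ F θ hP g₀ os).l₀ ∧ 0 < (cr₁₃ F θ hP g₀ os).vol ∧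
          (∀ (K : ℕ) (t : ℝ), |t| ≤ (cr₁₃ F θ hP g₀ os).l₀ →
            T4GenFunBounds.schemeZ ((datumOfRecord₁₃CoPR F 2 θ hP).scheme g₀) os ((cr₁₃ F θ hP g₀ os).K₀ + K) t =
              ∑ τ ∈ (cr₁₃ F θ hP g₀ os).T K, (cr₁₃ F θ hP g₀ os).A K t τ) ∧
          (∀ (K : ℕ) (t : ℝ), |t| ≤ (cr₁₃ F θ hP g₀ os).l₀ →
            T4GenFunBounds.schemeZ ((datumOfRecord₁₃CoPR F 2 θ hP).scheme g₀) os ((cr₁₃ F θ hP g₀ os).K₀ + K + 1) t =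
              ∑ τ ∈ (cr₁₃ F θ hP g₀ os).T K, (cr₁₃ F θ hP g₀ os).B K t τ))
    (h19 : ∀ (F : T4Family) (θ : Stage13RParams F 2) (hP : θ.Provisos₁₃CoPR F 2), (θ.ZrUnity F 2 ∧ θ.SlotsNondegenerate₁₃ F 2) → θ.Admissible F 2 →
      ∀ (g₀ : ℕ → ℝ) (os : List (ULoop F)), (∀ k : ℕ, RatesAt (datumOfRecord₁₃CoPR F 2 θ hP) (rateCarriersOfRecord₁₃CoPR 𝔯 F θ hP g₀ os k)) → letI := (cr₁₃ F θ hP g₀ os).dec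
        ∃ δ : ℕ → ℝ, NE7.Core (cr₁₃ F θ hP g₀ os).l₀ (cr₁₃ F θ hP g₀ os).vol (cr₁₃ F θ hP g₀ os).T (cr₁₃ F θ hP g₀ os).Bad
          (fun K t τ => (cr₁₃ F θ hP g₀ os).A K t τ - (cr₁₃ F θ hP g₀ os).shA K t τ)
          (fun K t τ => (cr₁₃ F θ hP g₀ os).B K t τ - (cr₁₃ F θ hP g₀ os).shB K t τ) δ ∧ Summable δ) :
    SpineGivenEndpointR13SepCoPR :=
  fun F θ hP hG hθ _ _ =>
    forall_guarded₁₃CoPR_of_homes₁₃CoPROn cr₁₃ 𝔯 (fun F θ => θ.ZrUnity F 2 ∧ θ.SlotsNondegenerate₁₃ F 2) h14 h15 h16 h17 h18 h22 h20 h21 hx h19 F θ hP.toCore hG hθ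

/-- **THE SAME WITH EVERY HYPOTHESIS IN ITS GUARDED θ-FORM** (`N = 2`; XXXIXᶜᵒᴾᴿ `forall_guarded₁₃CoPR_of_homes₁₃CoPROn_faces`): at every Stage-13 θ with provisos satisfying
`θ.ZrUnity F 2 ∧ θ.SlotsNondegenerate₁₃ F 2` and `θ.Admissible F 2`, every `g₀`, `os` — K4's six rates at EVERY run length `k` of the rate reading `rateCarriersOfRecord₁₃CoPR 𝔯 F θ hP g₀ os k` on
the datum of record · N20 `RelWeightBound` and N21 `ShellWeightBound` at the spine reading `cr₁₃ F θ hP g₀ os` · the keyed extraction clause · the same-tuple all-run-lengths N19′ edge ⇒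
`SpineGivenEndpointR13SepCoPR`.  The BC3-composer shape of §2's `spineGivenEndpointR13SepCoPR_of_keyedFaces` with the rate reading THE HOME's (run-length-indexed) and the edge fed the rates at all
run lengths. [bookkeeping] -/
theorem spineGivenEndpointR13SepCoPR_of_homes₁₃CoPROn_faces
    (hrates : ∀ (F : T4Family) (θ : Stage13RParams F 2) (hP : θ.Provisos₁₃CoPR F 2), (θ.ZrUnity F 2 ∧ θ.SlotsNondegenerate₁₃ F 2) → θ.Admissible F 2 →
      ∀ (g₀ : ℕ → ℝ) (os : List (ULoop F)) (k : ℕ), RatesAt (datumOfRecord₁₃CoPR F 2 θ hP) (rateCarriersOfRecord₁₃CoPR 𝔯 F θ hP g₀ os k))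
    (h20 : ∀ (F : T4Family) (θ : Stage13RParams F 2) (hP : θ.Provisos₁₃CoPR F 2), (θ.ZrUnity F 2 ∧ θ.SlotsNondegenerate₁₃ F 2) → θ.Admissible F 2 →
      ∀ (g₀ : ℕ → ℝ) (os : List (ULoop F)),
      RelWeightBound (cr₁₃ F θ hP g₀ os).l₀ (cr₁₃ F θ hP g₀ os).T (cr₁₃ F θ hP g₀ os).A (cr₁₃ F θ hP g₀ os).B (cr₁₃ F θ hP g₀ os).Bad (cr₁₃ F θ hP g₀ os).W)
    (h21 : ∀ (F : T4Family) (θ : Stage13RParams F 2) (hP : θ.Provisos₁₃CoPR F 2), (θ.ZrUnity F 2 ∧ θ.SlotsNondegenerate₁₃ F 2) → θ.Admissible F 2 →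
      ∀ (g₀ : ℕ → ℝ) (os : List (ULoop F)),
      ShellWeightBound (cr₁₃ F θ hP g₀ os).l₀ (cr₁₃ F θ hP g₀ os).T (cr₁₃ F θ hP g₀ os).A (cr₁₃ F θ hP g₀ os).B (cr₁₃ F θ hP g₀ os).shA (cr₁₃ F θ hP g₀ os).shB
        (cr₁₃ F θ hP g₀ os).Wsh)
    (hx : ∀ (F : T4Family) (θ : Stage13RParams F 2) (hP : θ.Provisos₁₃CoPR F 2), (θ.ZrUnity F 2 ∧ θ.SlotsNondegenerate₁₃ F 2) → θ.Admissible F 2 →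
      B16.EndStatementBPrinted (datumOfRecord₁₃CoPR F 2 θ hP).C → DagBinding.EndpointExistence (datumOfRecord₁₃CoPR F 2 θ hP).C.toB12 →
        ForSmallCouplings (datumOfRecord₁₃CoPR F 2 θ hP) fun g₀ => ∀ os : List (ULoop F),
          0 < (cr₁₃ F θ hP g₀ os).l₀ ∧ 0 < (cr₁₃ F θ hP g₀ os).vol ∧
          (∀ (K : ℕ) (t : ℝ), |t| ≤ (cr₁₃ F θ hP g₀ os).l₀ →
            T4GenFunBounds.schemeZ ((datumOfRecord₁₃CoPR F 2 θ hP).scheme g₀) os ((cr₁₃ F θ hP g₀ os).K₀ + K) t =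
              ∑ τ ∈ (cr₁₃ F θ hP g₀ os).T K, (cr₁₃ F θ hP g₀ os).A K t τ) ∧
          (∀ (K : ℕ) (t : ℝ), |t| ≤ (cr₁₃ F θ hP g₀ os).l₀ →
            T4GenFunBounds.schemeZ ((datumOfRecord₁₃CoPR F 2 θ hP).scheme g₀) os ((cr₁₃ F θ hP g₀ os).K₀ + K + 1) t =
              ∑ τ ∈ (cr₁₃ F θ hP g₀ os).T K, (cr₁₃ F θ hP g₀ os).B K t τ))
    (h19 : ∀ (F : T4Family) (θ : Stage13RParams F 2) (hP : θ.Provisos₁₃CoPR F 2), (θ.ZrUnity F 2 ∧ θ.SlotsNondegenerate₁₃ F 2) → θ.Admissible F 2 →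
      ∀ (g₀ : ℕ → ℝ) (os : List (ULoop F)), (∀ k : ℕ, RatesAt (datumOfRecord₁₃CoPR F 2 θ hP) (rateCarriersOfRecord₁₃CoPR 𝔯 F θ hP g₀ os k)) → letI := (cr₁₃ F θ hP g₀ os).dec
        ∃ δ : ℕ → ℝ, NE7.Core (cr₁₃ F θ hP g₀ os).l₀ (cr₁₃ F θ hP g₀ os).vol (cr₁₃ F θ hP g₀ os).T (cr₁₃ F θ hP g₀ os).Bad
          (fun K t τ => (cr₁₃ F θ hP g₀ os).A K t τ - (cr₁₃ F θ hP g₀ os).shA K t τ)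
          (fun K t τ => (cr₁₃ F θ hP g₀ os).B K t τ - (cr₁₃ F θ hP g₀ os).shB K t τ) δ ∧ Summable δ) :
    SpineGivenEndpointR13SepCoPR :=
  fun F θ hP hG hθ _ _ =>
    forall_guarded₁₃CoPR_of_homes₁₃CoPROn_faces cr₁₃ 𝔯 (fun F θ => θ.ZrUnity F 2 ∧ θ.SlotsNondegenerate₁₃ F 2) hrates h20 h21 hx h19 F θ hP.toCore hG hθ

end HomesOn

/-! ## §7 The item from the stubs at the guard-restricted homes THROUGH RR-2's CN record class (module XXXIXᶜᵒᴾᴿ `spine_rec13CCoPRN_of_homes₁₃CoPROn`) -/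

section HomesCN

/-- **THE ITEM FROM THE STUBS AT THE GUARD-RESTRICTED HOMES, THROUGH THE CN RECORD CLASS** (`N = 2`; XXXIXᶜᵒᴾᴿ `spine_rec13CCoPRN_of_homes₁₃CoPROn` ∘ `spineGivenEndpointR13SepCoPR_of_spine_rec13CCoPRN`):
§6's `spineGivenEndpointR13SepCoPR_of_homes₁₃CoPROn` with the regime spelled `Node00.unityNondeg₁₃R 2` (RR-2's name for the guard of record) — the same term up to the abbreviation.
[bookkeeping] -/
theorem spineGivenEndpointR13SepCoPR_of_homes₁₃CoPRCN (cr₁₃ : SpineReading₁₃CoPR 2) (𝔯 : RateReading₁₃CoPR 2)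
    (h14 : S_N14 (RRec₁₃CoPROn 𝔯 (Node00.unityNondeg₁₃R 2))) (h15 : S_N15 (RRec₁₃CoPROn 𝔯 (Node00.unityNondeg₁₃R 2))) (h16 : S_N16 (RRec₁₃CoPROn 𝔯 (Node00.unityNondeg₁₃R 2)))
    (h17 : S_N17 (RRec₁₃CoPROn 𝔯 (Node00.unityNondeg₁₃R 2))) (h18 : S_N18 (RRec₁₃CoPROn 𝔯 (Node00.unityNondeg₁₃R 2))) (h22 : S_N22 (RRec₁₃CoPROn 𝔯 (Node00.unityNondeg₁₃R 2)))
    (h20 : S_N20 (SRec₁₃CoPROn cr₁₃ (Node00.unityNondeg₁₃R 2))) (h21 : S_N21 (SRec₁₃CoPROn cr₁₃ (Node00.unityNondeg₁₃R 2)))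
    (hx : ∀ (F : T4Family) (θ : Stage13RParams F 2) (hP : θ.Provisos₁₃CoPR F 2), (θ.ZrUnity F 2 ∧ θ.SlotsNondegenerate₁₃ F 2) → θ.Admissible F 2 →
      B16.EndStatementBPrinted (datumOfRecord₁₃CoPR F 2 θ hP).C → DagBinding.EndpointExistence (datumOfRecord₁₃CoPR F 2 θ hP).C.toB12 →
        ForSmallCouplings (datumOfRecord₁₃CoPR F 2 θ hP) fun g₀ => ∀ os : List (ULoop F),
          0 < (cr₁₃ F θ hP g₀ os).l₀ ∧ 0 < (cr₁₃ F θ hP g₀ os).vol ∧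
          (∀ (K : ℕ) (t : ℝ), |t| ≤ (cr₁₃ F θ hP g₀ os).l₀ →
            T4GenFunBounds.schemeZ ((datumOfRecord₁₃CoPR F 2 θ hP).scheme g₀) os ((cr₁₃ F θ hP g₀ os).K₀ + K) t =
              ∑ τ ∈ (cr₁₃ F θ hP g₀ os).T K, (cr₁₃ F θ hP g₀ os).A K t τ) ∧
          (∀ (K : ℕ) (t : ℝ), |t| ≤ (cr₁₃ F θ hP g₀ os).l₀ →
            T4GenFunBounds.schemeZ ((datumOfRecord₁₃CoPR F 2 θ hP).scheme g₀) os ((cr₁₃ F θ hP g₀ os).K₀ + K + 1) t =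
              ∑ τ ∈ (cr₁₃ F θ hP g₀ os).T K, (cr₁₃ F θ hP g₀ os).B K t τ))
    (h19 : ∀ (F : T4Family) (θ : Stage13RParams F 2) (hP : θ.Provisos₁₃CoPR F 2), (θ.ZrUnity F 2 ∧ θ.SlotsNondegenerate₁₃ F 2) → θ.Admissible F 2 →
      ∀ (g₀ : ℕ → ℝ) (os : List (ULoop F)), (∀ k : ℕ, RatesAt (datumOfRecord₁₃CoPR F 2 θ hP) (rateCarriersOfRecord₁₃CoPR 𝔯 F θ hP g₀ os k)) → letI := (cr₁₃ F θ hP g₀ os).dec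
        ∃ δ : ℕ → ℝ, NE7.Core (cr₁₃ F θ hP g₀ os).l₀ (cr₁₃ F θ hP g₀ os).vol (cr₁₃ F θ hP g₀ os).T (cr₁₃ F θ hP g₀ os).Bad
          (fun K t τ => (cr₁₃ F θ hP g₀ os).A K t τ - (cr₁₃ F θ hP g₀ os).shA K t τ)
          (fun K t τ => (cr₁₃ F θ hP g₀ os).B K t τ - (cr₁₃ F θ hP g₀ os).shB K t τ) δ ∧ Summable δ) :
    SpineGivenEndpointR13SepCoPR :=
  fun F θ hP hG hθ _ _ =>
    (spine_rec13CCoPRN_iff_forall_guarded (N := 2)).mp (spine_rec13CCoPRN_of_homes₁₃CoPROn cr₁₃ 𝔯 h14 h15 h16 h17 h18 h22 h20 h21 hx h19) F θ hP.toCore hG hθ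

end HomesCN

/-! ## §8 (v1.2, append-only) THE ITEM AT dag-n22-e's STAGE-13 RATE READING OF RECORD `readingOfRecord₁₃CoPR w1 ℓ₃ ne2 ne1` (module XLᶜᵒᴾᴿ by name) -/

section ReadingOfRecord

open Node00 (IsDatumOfRecord₁₃CCoPR NE3Letters₁₁ NE2Objects₁₁ ne3ConstLayerOfRecord₁₁)
open Summit.QuantumFields.YangMills.BalabanUVNodes.N16Regime (InEndRegime)
open Summit.QuantumFields.YangMills.BalabanUVNodes.N16LeafSlot (LeafSlot)

variable (cr₁₃ : SpineReading₁₃CoPR 2)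
  (w1 : (F : T4Family) → (θ : Stage13RParams F 2) → Node00.W1.ReadingData F (Node00.MatA 2) θ.τ9.M) (ℓ₃ : T4Family → NE3Letters₁₁)
  (ne2 : (F : T4Family) → Stage13RParams F 2 → (ℕ → ℝ) → List (ULoop F) → ℕ → NE2Objects₁₁)
  (ne1 : (F : T4Family) → Stage13RParams F 2 → (ℕ → ℝ) → List (ULoop F) → NE1pCarriers)

/-- **K3⁶ FROM THE RATE SENTENCES AT THE GUARD-RESTRICTED HOME OF THE ⁗ READING OF RECORD** (`N = 2`; §4 `spineGivenEndpointR13SepCoPR_of_spine_rec13CCoPROn` ∘ XLᶜᵒᴾᴿ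
`spine_rec13CCoPROn_at_readingOfRecord₁₃CoPR_of_leafSlot`): NE1′ on `ne1`, NE2 on `ne2`, NE5 ∕ NE9 ∕ (D4) on `(w1 F θ).u3Objects θ.γ`, `InEndRegime ∧ LeafSlot` per guarded family, N17
ELIMINATED, N20 ∕ N21 at `SRec₁₃CoPROn cr₁₃ (guard)`, the guarded extraction clause, the same-tuple N19′ edge — the guard reaching EVERY hypothesis (all 0∕1 today). [bookkeeping] -/
theorem spineGivenEndpointR13SepCoPR_at_readingOfRecord₁₃CoPROn
    (h14 : ∀ (F : T4Family) (θ : Stage13RParams F 2), θ.Provisos₁₃CoPR F 2 → (θ.ZrUnity F 2 ∧ θ.SlotsNondegenerate₁₃ F 2) → θ.Admissible F 2 →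
      ∀ (g₀ : ℕ → ℝ) (os : List (ULoop F)), N14At (ne1 F θ g₀ os))
    (h15 : ∀ (F : T4Family) (θ : Stage13RParams F 2), θ.Provisos₁₃CoPR F 2 → (θ.ZrUnity F 2 ∧ θ.SlotsNondegenerate₁₃ F 2) → θ.Admissible F 2 →
      ∀ (g₀ : ℕ → ℝ) (os : List (ULoop F)) (k : ℕ), N15At (ne2OfRecord₁₁ (ne2 F θ g₀ os k)))
    (h16 : ∀ (F : T4Family), (∃ θ : Stage13RParams F 2, θ.Provisos₁₃CoPR F 2 ∧ (θ.ZrUnity F 2 ∧ θ.SlotsNondegenerate₁₃ F 2) ∧ θ.Admissible F 2) →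
      InEndRegime (ne3OfRecord₁₁ F (ne3ConstLayerOfRecord₁₁ F 2 (ℓ₃ F))) ∧ LeafSlot (ne3OfRecord₁₁ F (ne3ConstLayerOfRecord₁₁ F 2 (ℓ₃ F))))
    (h18 : ∀ (F : T4Family) (θ : Stage13RParams F 2), θ.Provisos₁₃CoPR F 2 → (θ.ZrUnity F 2 ∧ θ.SlotsNondegenerate₁₃ F 2) → θ.Admissible F 2 → ∀ k : ℕ,
      N18At (u3OfRecord₁₃ θ.toStage13Params ((w1 F θ).u3Objects θ.γ) k))
    (h22 : ∀ (F : T4Family) (θ : Stage13RParams F 2), θ.Provisos₁₃CoPR F 2 → (θ.ZrUnity F 2 ∧ θ.SlotsNondegenerate₁₃ F 2) → θ.Admissible F 2 → ∀ k : ℕ,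
      N22At (u3OfRecord₁₃ θ.toStage13Params ((w1 F θ).u3Objects θ.γ) k))
    (hD4 : ∀ (F : T4Family) (θ : Stage13RParams F 2) (hP : θ.Provisos₁₃CoPR F 2), (θ.ZrUnity F 2 ∧ θ.SlotsNondegenerate₁₃ F 2) → θ.Admissible F 2 → ∀ k : ℕ,
      ReadOutAt (datumOfRecord₁₃CoPR F 2 θ hP) (u3OfRecord₁₃ θ.toStage13Params ((w1 F θ).u3Objects θ.γ) k))
    (h20 : S_N20 (SRec₁₃CoPROn cr₁₃ fun F θ => θ.ZrUnity F 2 ∧ θ.SlotsNondegenerate₁₃ F 2))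
    (h21 : S_N21 (SRec₁₃CoPROn cr₁₃ fun F θ => θ.ZrUnity F 2 ∧ θ.SlotsNondegenerate₁₃ F 2))
    (hx : ∀ (F : T4Family) (θ : Stage13RParams F 2) (hP : θ.Provisos₁₃CoPR F 2), (θ.ZrUnity F 2 ∧ θ.SlotsNondegenerate₁₃ F 2) → θ.Admissible F 2 →
      B16.EndStatementBPrinted (datumOfRecord₁₃CoPR F 2 θ hP).C → DagBinding.EndpointExistence (datumOfRecord₁₃CoPR F 2 θ hP).C.toB12 →
        ForSmallCouplings (datumOfRecord₁₃CoPR F 2 θ hP) fun g₀ => ∀ os : List (ULoop F),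
          0 < (cr₁₃ F θ hP g₀ os).l₀ ∧ 0 < (cr₁₃ F θ hP g₀ os).vol ∧
          (∀ (K : ℕ) (t : ℝ), |t| ≤ (cr₁₃ F θ hP g₀ os).l₀ →
            T4GenFunBounds.schemeZ ((datumOfRecord₁₃CoPR F 2 θ hP).scheme g₀) os ((cr₁₃ F θ hP g₀ os).K₀ + K) t =
              ∑ τ ∈ (cr₁₃ F θ hP g₀ os).T K, (cr₁₃ F θ hP g₀ os).A K t τ) ∧
          (∀ (K : ℕ) (t : ℝ), |t| ≤ (cr₁₃ F θ hP g₀ os).l₀ →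
            T4GenFunBounds.schemeZ ((datumOfRecord₁₃CoPR F 2 θ hP).scheme g₀) os ((cr₁₃ F θ hP g₀ os).K₀ + K + 1) t =
              ∑ τ ∈ (cr₁₃ F θ hP g₀ os).T K, (cr₁₃ F θ hP g₀ os).B K t τ))
    (h19 : ∀ (F : T4Family) (θ : Stage13RParams F 2) (hP : θ.Provisos₁₃CoPR F 2), (θ.ZrUnity F 2 ∧ θ.SlotsNondegenerate₁₃ F 2) → θ.Admissible F 2 →
      ∀ (g₀ : ℕ → ℝ) (os : List (ULoop F)),
      (∀ k : ℕ, RatesAt (datumOfRecord₁₃CoPR F 2 θ hP) (rateCarriersOfRecord₁₃CoPR (readingOfRecord₁₃CoPR w1 ℓ₃ ne2 ne1) F θ hP g₀ os k)) → letI := (cr₁₃ F θ hP g₀ os).dec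
        ∃ δ : ℕ → ℝ, NE7.Core (cr₁₃ F θ hP g₀ os).l₀ (cr₁₃ F θ hP g₀ os).vol (cr₁₃ F θ hP g₀ os).T (cr₁₃ F θ hP g₀ os).Bad
          (fun K t τ => (cr₁₃ F θ hP g₀ os).A K t τ - (cr₁₃ F θ hP g₀ os).shA K t τ)
          (fun K t τ => (cr₁₃ F θ hP g₀ os).B K t τ - (cr₁₃ F θ hP g₀ os).shB K t τ) δ ∧ Summable δ) :
    SpineGivenEndpointR13SepCoPR :=
  fun F θ hP hG hθ _ _ =>
    (spine_rec13CCoPROn_iff_forall_guarded fun F θ => θ.ZrUnity F 2 ∧ θ.SlotsNondegenerate₁₃ F 2).mp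
      (spine_rec13CCoPROn_at_readingOfRecord₁₃CoPR_of_leafSlot cr₁₃ w1 ℓ₃ ne2 ne1 (fun F θ => θ.ZrUnity F 2 ∧ θ.SlotsNondegenerate₁₃ F 2)
        h14 h15 h16 h18 h22 hD4 h20 h21 hx h19) F θ hP.toCore hG hθ

end ReadingOfRecord

end Summit.QuantumFields.YangMills.Theorems.BalabanUVNodesN27SpineRecord
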